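import Mathlib
import HarnessLib
import Summits.QuantumAdvantage.QuantumAdvantage.Theorems.DigitDialK

set_option linter.dupNamespace false
set_option autoImplicit false

/-!
# DigitDial (N) — the LONG-MEMORY TRANSFER: twisted walk transfer with `w+1` BITS OF MEMORY (cell decomp-qadv, lens 4, g20 rev 8)

Prop-definition-free tree twin of §11a–c of the lens-4 g20 node `DigitDial`.  Part K carries the walk state together with
ONE previous bit; here the backward vector lives on `ℤ/3 × {0,1}^{w+1}` (the last `w+1` bits, oldest first) and the site
operator `(T v)(s,b) = ½(v(s+1, b⁺0) + ζ(b)·η·v(s+2, b⁺1))` (`b⁺β` = drop the oldest bit, append `β`) carries a phase `ζ(b)`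
depending on the whole memory — the transfer form of a BANDED QUADRATIC phase `e_M(Σ_i u_i (l_i + Σ_{d≤w} q_{i,d} u_{i-(w+1)+d}))`.
* `key_ineq2`: `|a + ζ₀x|² + |a + ζ₁x|² ≤ 2(1+λ)(|a|² + |x|²)` whenever `|ζ₀|, |ζ₁| ≤ 1`, `|ζ₀ + ζ₁| ≤ 2λ`;
* `cnsqW_twAvgW_le`: the two memories differing only in the OLDEST bit feed the same two components, so the step contracts the
  squared norm by `(1+λ)/2` as soon as `|ζ(0::b') + ζ(1::b')| ≤ 2λ` for all `b'` — for EVERY modulus, no coprimality;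
* `memAt`, `memAt_cons_succ`, `pathSumW_eq`: the long-memory path sum equals `2^k · TBVW`;
* `cnsqW_TBVW_le`, `cnsqW_TBVW_zero_le` (`≤ 2^{w+1}`): norm propagation along the walk.
0 sorry; axioms standard; no `instance`, no `notation`, no `native_decide`; no `def … : Prop`.
-/

noncomputable section

namespace Summit.QuantumAdvantage.QuantumAdvantage.Theorems.DigitDial

open Finset Summit.QuantumAdvantage.AdviceFreeQNC0 Literature.Computability.MetaComplexity
open TwistedTransfer ConstBells

namespace TwistW

open ComplexConjugate TwistQ

variable {w : ℕ}

/-- Squared norm on the state space `ℤ/3 × {0,1}^{w+1}`. -/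
def cnsqW (v : ZMod 3 → (Fin (w + 1) → Bool) → ℂ) : ℝ := ∑ b : Fin (w + 1) → Bool, cnsq (fun s => v s b)

/-- `cnsqW ≥ 0`. -/
theorem cnsqW_nonneg (v : ZMod 3 → (Fin (w + 1) → Bool) → ℂ) : 0 ≤ cnsqW v :=
  Finset.sum_nonneg fun _ _ => cnsq_nonneg _

/-- A coordinate is bounded by the norm. -/
theorem normSq_le_cnsqW (v : ZMod 3 → (Fin (w + 1) → Bool) → ℂ) (s : ZMod 3) (b : Fin (w + 1) → Bool) :
    ‖v s b‖ ^ 2 ≤ cnsqW v := by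
  unfold cnsqW
  refine le_trans (normSq_le_cnsq (fun s => v s b) s) ?_
  exact Finset.single_le_sum (f := fun b' => cnsq (fun s => v s b')) (fun b' _ => cnsq_nonneg _) (Finset.mem_univ b)

/-- Append the new bit `β` as the most recent memory coordinate (index `w`) after the older ones `b'`. -/
def shiftIn (β : Bool) (b' : Fin w → Bool) : Fin (w + 1) → Bool := fun d => if h : d.val < w then b' ⟨d.val, h⟩ else β

/-- Drop the OLDEST memory coordinate (index `0`). -/
def dropOld (b : Fin (w + 1) → Bool) : Fin w → Bool := fun d => b ⟨d.val + 1, by omega⟩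

/-- `dropOld (c :: b') = b'`. -/
theorem dropOld_cons (c : Bool) (b' : Fin w → Bool) : dropOld (Fin.cons c b' : Fin (w + 1) → Bool) = b' := by
  funext d
  show (Fin.cons c b' : Fin (w + 1) → Bool) d.succ = b' d
  rw [Fin.cons_succ]

/-- `shiftIn β b'` evaluated at the last coordinate is `β`. -/
theorem shiftIn_last (β : Bool) (b' : Fin w → Bool) : shiftIn β b' (Fin.last w) = β := by
  unfold shiftIn; simp

/-- `shiftIn β b'` evaluated at an old coordinate. -/
theorem shiftIn_castSucc (β : Bool) (b' : Fin w → Bool) (d : Fin w) : shiftIn β b' (Fin.castSucc d) = b' d := by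
  unfold shiftIn; simp

/-- `(β, b') ↦ shiftIn β b'` is a bijection `Bool × {0,1}^w ≃ {0,1}^{w+1}`. -/
def shiftEquiv (w : ℕ) : Bool × (Fin w → Bool) ≃ (Fin (w + 1) → Bool) where
  toFun p := shiftIn p.1 p.2
  invFun b := (b (Fin.last w), fun d => b (Fin.castSucc d))
  left_inv p := by
    obtain ⟨β, b'⟩ := p
    simp only [shiftIn_last, shiftIn_castSucc]
  right_inv b := by
    funext d
    show shiftIn (b (Fin.last w)) (fun d => b (Fin.castSucc d)) d = b d
    have hd' := d.isLt
    unfold shiftIn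
    by_cases hd : d.val < w
    · rw [dif_pos hd]; rfl
    · rw [dif_neg hd]; congr 1; exact Fin.ext (by simp; omega)

/-- The twisted step WITH `w+1` BITS OF MEMORY: a new bit `0` moves the walk state by `+1` (phase `1`); a new bit `1` moves it by
`+2` with phase `ζ(b)·η` depending on the whole memory `b`; either way the oldest memory bit is dropped and the new bit appended. -/
def twAvgW (ζ : (Fin (w + 1) → Bool) → ℂ) (η : ℂ) (v : ZMod 3 → (Fin (w + 1) → Bool) → ℂ) :
    ZMod 3 → (Fin (w + 1) → Bool) → ℂ :=
  fun s b => (v (s + 1) (shiftIn false (dropOld b)) + ζ b * (η * v (s + 2) (shiftIn true (dropOld b)))) / 2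

/-- Multiplication by a real factor family (the bell signs). -/
def rMulW (d : ZMod 3 → ℝ) (v : ZMod 3 → (Fin (w + 1) → Bool) → ℂ) : ZMod 3 → (Fin (w + 1) → Bool) → ℂ :=
  fun s b => (d s : ℂ) * v s b

/-- A real factor family bounded by `1` does not expand the norm. -/
theorem cnsqW_rMulW_le {d : ZMod 3 → ℝ} (hd : ∀ s, d s ^ 2 ≤ 1) (v : ZMod 3 → (Fin (w + 1) → Bool) → ℂ) :
    cnsqW (rMulW d v) ≤ cnsqW v :=
  Finset.sum_le_sum fun b _ => cnsq_rMul_le hd (fun s => v s b)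

/-- **The key scalar inequality, two phases**: `|a + ζ₀x|² + |a + ζ₁x|² ≤ 2(1+λ)(|a|² + |x|²)` whenever `|ζ₀|, |ζ₁| ≤ 1` and
`|ζ₀ + ζ₁| ≤ 2λ`. -/
theorem key_ineq2 (a x ζ₀ ζ₁ : ℂ) {lam : ℝ} (h0 : ‖ζ₀‖ ≤ 1) (h1 : ‖ζ₁‖ ≤ 1) (hl : ‖ζ₀ + ζ₁‖ ≤ 2 * lam) :
    ‖a + ζ₀ * x‖ ^ 2 + ‖a + ζ₁ * x‖ ^ 2 ≤ 2 * (1 + lam) * (‖a‖ ^ 2 + ‖x‖ ^ 2) := by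
  have hlam : 0 ≤ lam := by have := norm_nonneg (ζ₀ + ζ₁); linarith
  have e : ‖a + ζ₀ * x‖ ^ 2 + ‖a + ζ₁ * x‖ ^ 2 =
      2 * ‖a‖ ^ 2 + ‖ζ₀ * x‖ ^ 2 + ‖ζ₁ * x‖ ^ 2 + 2 * (a * conj x * conj (ζ₀ + ζ₁)).re := by
    have e1 : ‖a + ζ₀ * x‖ ^ 2 = ‖a‖ ^ 2 + ‖ζ₀ * x‖ ^ 2 + 2 * (a * conj (ζ₀ * x)).re := by
      rw [Complex.sq_norm, Complex.sq_norm, Complex.sq_norm, Complex.normSq_add]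
    have e2 : ‖a + ζ₁ * x‖ ^ 2 = ‖a‖ ^ 2 + ‖ζ₁ * x‖ ^ 2 + 2 * (a * conj (ζ₁ * x)).re := by
      rw [Complex.sq_norm, Complex.sq_norm, Complex.sq_norm, Complex.normSq_add]
    have e3 : (a * conj x * conj (ζ₀ + ζ₁)).re = (a * conj (ζ₀ * x)).re + (a * conj (ζ₁ * x)).re := by
      rw [← Complex.add_re, map_add, map_mul, map_mul]; congr 1; ring
    rw [e1, e2, e3]; ring
  have h2 : (a * conj x * conj (ζ₀ + ζ₁)).re ≤ ‖a‖ * ‖x‖ * (2 * lam) := by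
    refine (Complex.re_le_norm _).trans ?_
    rw [norm_mul, norm_mul, Complex.norm_conj, Complex.norm_conj]
    exact mul_le_mul_of_nonneg_left hl (by positivity)
  have hx0 : ‖ζ₀ * x‖ ^ 2 ≤ ‖x‖ ^ 2 := by
    rw [norm_mul]
    have hx := norm_nonneg x
    have : ‖ζ₀‖ * ‖x‖ ≤ ‖x‖ := mul_le_of_le_one_left hx h0
    exact pow_le_pow_left₀ (by positivity) this 2
  have hx1 : ‖ζ₁ * x‖ ^ 2 ≤ ‖x‖ ^ 2 := by
    rw [norm_mul]
    have hx := norm_nonneg x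
    have : ‖ζ₁‖ * ‖x‖ ≤ ‖x‖ := mul_le_of_le_one_left hx h1
    exact pow_le_pow_left₀ (by positivity) this 2
  have h4 : 2 * (‖a‖ * ‖x‖) ≤ ‖a‖ ^ 2 + ‖x‖ ^ 2 := by nlinarith [sq_nonneg (‖a‖ - ‖x‖)]
  rw [e]
  nlinarith [h2, hx0, hx1, h4, hlam, mul_nonneg (mul_nonneg (norm_nonneg a) (norm_nonneg x)) hlam]

/-- `cnsq` of a shifted vector through its three components. -/
theorem cnsq_three (v : ZMod 3 → ℂ) : cnsq v = ‖v 0‖ ^ 2 + ‖v 1‖ ^ 2 + ‖v 2‖ ^ 2 := rfl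

/-- **Per-site contraction of the long-memory step**: `‖T v‖² ≤ ((1+λ)/2)·‖v‖²` when `|η| ≤ 1`, `|ζ(b)| ≤ 1` for all `b`, and
the two memories differing in the OLDEST bit have `|ζ(0::b') + ζ(1::b')| ≤ 2λ`. -/
theorem cnsqW_twAvgW_le {ζ : (Fin (w + 1) → Bool) → ℂ} {η : ℂ} {lam : ℝ} (hη : ‖η‖ ≤ 1) (hζ : ∀ b, ‖ζ b‖ ≤ 1)
    (hl : ∀ b' : Fin w → Bool, ‖ζ (Fin.cons false b') + ζ (Fin.cons true b')‖ ≤ 2 * lam)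
    (v : ZMod 3 → (Fin (w + 1) → Bool) → ℂ) : cnsqW (twAvgW ζ η v) ≤ (1 + lam) / 2 * cnsqW v := by
  have hlam : 0 ≤ lam := by
    have := norm_nonneg (ζ (Fin.cons false fun _ => false) + ζ (Fin.cons true fun _ => false))
    have := hl (fun _ => false); linarith
  -- the pair inequality at one walk state
  have hsite : ∀ (b' : Fin w → Bool) (a y : ℂ),
      ‖(a + ζ (Fin.cons false b') * (η * y)) / 2‖ ^ 2 + ‖(a + ζ (Fin.cons true b') * (η * y)) / 2‖ ^ 2 ≤
        (1 + lam) / 2 * (‖a‖ ^ 2 + ‖y‖ ^ 2) := by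
    intro b' a y
    rw [norm_div, norm_div, Complex.norm_ofNat, div_pow, div_pow]
    have hk := key_ineq2 a (η * y) _ _ (hζ (Fin.cons false b')) (hζ (Fin.cons true b')) (hl b')
    have hx : ‖η * y‖ ^ 2 ≤ ‖y‖ ^ 2 := by
      rw [norm_mul]
      have hw := norm_nonneg y
      have : ‖η‖ * ‖y‖ ≤ ‖y‖ := mul_le_of_le_one_left hw hη
      exact pow_le_pow_left₀ (by positivity) this 2
    nlinarith
  -- split the memory sum of the left side over the oldest bit, of the right side over the newest bit
  have hL : cnsqW (twAvgW ζ η v) = ∑ b' : Fin w → Bool,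
      (cnsq (fun s => twAvgW ζ η v s (Fin.cons false b')) + cnsq (fun s => twAvgW ζ η v s (Fin.cons true b'))) := by
    unfold cnsqW
    rw [← Fintype.sum_equiv (Fin.consEquiv fun _ : Fin (w + 1) => Bool)
      (fun p : Bool × (Fin w → Bool) => cnsq (fun s => twAvgW ζ η v s (Fin.cons p.1 p.2))) _ (fun p => rfl),
      Fintype.sum_prod_type, Fintype.sum_bool]
    rw [← Finset.sum_add_distrib]
    refine Finset.sum_congr rfl fun b' _ => ?_
    ring
  have hR : cnsqW v = ∑ b' : Fin w → Bool, (cnsq (fun s => v s (shiftIn false b')) + cnsq (fun s => v s (shiftIn true b'))) := by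
    unfold cnsqW
    rw [← Fintype.sum_equiv (shiftEquiv w) (fun p : Bool × (Fin w → Bool) => cnsq (fun s => v s (shiftIn p.1 p.2))) _
      (fun p => rfl), Fintype.sum_prod_type, Fintype.sum_bool]
    rw [← Finset.sum_add_distrib]
    refine Finset.sum_congr rfl fun b' _ => ?_
    ring
  rw [hL, hR, Finset.mul_sum]
  refine Finset.sum_le_sum fun b' _ => ?_
  unfold twAvgW
  simp only [dropOld_cons, cnsq_three, z3_tab]
  have t0 := hsite b' (v 1 (shiftIn false b')) (v 2 (shiftIn true b'))
  have t1 := hsite b' (v 2 (shiftIn false b')) (v 0 (shiftIn true b'))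
  have t2 := hsite b' (v 0 (shiftIn false b')) (v 1 (shiftIn true b'))
  nlinarith [t0, t1, t2]

/-! ### 11b. The long-memory transfer vector and the path sum -/

/-- The long-memory backward vector. -/
def TBVW (ζ : ℕ → (Fin (w + 1) → Bool) → ℂ) (η : ℕ → ℂ) (f : ℕ → ZMod 3 → ℝ) :
    ℕ → ℕ → ZMod 3 → (Fin (w + 1) → Bool) → ℂ
  | g, 0 => fun s _ => (f g s : ℂ)
  | g, k + 1 => rMulW (f g) (twAvgW (ζ g) (η g) (TBVW ζ η f (g + 1) k))

/-- `TBVW` with no step left. -/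
theorem TBVW_zero (ζ : ℕ → (Fin (w + 1) → Bool) → ℂ) (η : ℕ → ℂ) (f : ℕ → ZMod 3 → ℝ) (g : ℕ) :
    TBVW ζ η f g 0 = fun s _ => (f g s : ℂ) := rfl

/-- `TBVW` recursion. -/
theorem TBVW_succ (ζ : ℕ → (Fin (w + 1) → Bool) → ℂ) (η : ℕ → ℂ) (f : ℕ → ZMod 3 → ℝ) (g k : ℕ) :
    TBVW ζ η f g (k + 1) = rMulW (f g) (twAvgW (ζ g) (η g) (TBVW ζ η f (g + 1) k)) := rfl

/-- The MEMORY at position `i` of the word `u` (the `w+1` bits before `i`, oldest first), the bits before position `0` being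
the initial memory `b₀`. -/
def memAt {k : ℕ} (b₀ : Fin (w + 1) → Bool) (u : Fin k → Bool) (i : ℕ) : Fin (w + 1) → Bool :=
  fun d => if h : i + d.val < w + 1 then b₀ ⟨i + d.val, h⟩ else bitAt u (i + d.val - (w + 1))

/-- At position `0` the memory is the initial memory. -/
theorem memAt_zero {k : ℕ} (b₀ : Fin (w + 1) → Bool) (u : Fin k → Bool) : memAt b₀ u 0 = b₀ := by
  funext d
  unfold memAt
  rw [dif_pos (by omega)]
  congr 1
  exact Fin.ext (by simp)

/-- Peeling the first bit: `memAt b₀ (β :: u') (i+1) = memAt (shiftIn β (dropOld b₀)) u' i`. -/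
theorem memAt_cons_succ {k : ℕ} (b₀ : Fin (w + 1) → Bool) (β : Bool) (u' : Fin k → Bool) (i : ℕ) :
    memAt b₀ (Fin.cons β u' : Fin (k + 1) → Bool) (i + 1) = memAt (shiftIn β (dropOld b₀)) u' i := by
  funext d
  unfold memAt
  by_cases h1 : i + 1 + d.val < w + 1
  · rw [dif_pos h1, dif_pos (by omega)]
    unfold shiftIn dropOld
    rw [dif_pos (by simp; omega)]
    congr 1
    exact Fin.ext (by simp; omega)
  · by_cases h2 : i + d.val < w + 1
    · rw [dif_neg h1, dif_pos h2]
      unfold shiftIn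
      rw [dif_neg (by simp; omega), show i + 1 + d.val - (w + 1) = 0 from by omega, bitAt_cons_zero]
    · rw [dif_neg h1, dif_neg h2, show i + 1 + d.val - (w + 1) = (i + d.val - (w + 1)) + 1 from by omega,
        bitAt_cons_succ]

/-- The site phase of the long-memory walk: `1` on a `0`-bit, `ζ(memory)·η` on a `1`-bit. -/
def qphW (ζ : (Fin (w + 1) → Bool) → ℂ) (η : ℂ) (bit : Bool) (mem : Fin (w + 1) → Bool) : ℂ :=
  if bit then ζ mem * η else 1

/-- **Long-memory path sum = long-memory backward vector**:
`Σ_u (Π_{j ≤ k} f_{g+j}(s + j + W_j(u))) · Π_{i<k} qphW(ζ_{g+i}, η_{g+i}, u_i, mem_i(u)) = 2^k · TBVW_g k s b₀`. -/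
theorem pathSumW_eq (ζ : ℕ → (Fin (w + 1) → Bool) → ℂ) (η : ℕ → ℂ) (f : ℕ → ZMod 3 → ℝ) (k : ℕ) :
    ∀ (g : ℕ) (s : ZMod 3) (b₀ : Fin (w + 1) → Bool),
    (∑ u : Fin k → Bool, ((∏ j ∈ range (k + 1), f (g + j) (s + ((j + wtPrefix u j : ℕ) : ZMod 3)) : ℝ) : ℂ) *
        ∏ i : Fin k, qphW (ζ (g + i.val)) (η (g + i.val)) (u i) (memAt b₀ u i.val)) =
      2 ^ k * TBVW ζ η f g k s b₀ := by
  induction k with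
  | zero =>
    intro g s b₀
    rw [TBVW_zero]
    simp [wtPrefix_zero]
  | succ k ih =>
    intro g s b₀
    rw [TBVW_succ]
    rw [← Fintype.sum_equiv (Fin.consEquiv fun _ : Fin (k + 1) => Bool)
      (fun p : Bool × (Fin k → Bool) => ((∏ j ∈ range (k + 1 + 1),
        f (g + j) (s + ((j + wtPrefix (Fin.cons p.1 p.2 : Fin (k + 1) → Bool) j : ℕ) : ZMod 3)) : ℝ) : ℂ) *
        ∏ i : Fin (k + 1), qphW (ζ (g + i.val)) (η (g + i.val)) ((Fin.cons p.1 p.2 : Fin (k + 1) → Bool) i)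
          (memAt b₀ (Fin.cons p.1 p.2 : Fin (k + 1) → Bool) i.val))
      _ (fun p => rfl), Fintype.sum_prod_type]
    have hinner : ∀ b : Bool, (∑ u' : Fin k → Bool, ((∏ j ∈ range (k + 1 + 1),
        f (g + j) (s + ((j + wtPrefix (Fin.cons b u' : Fin (k + 1) → Bool) j : ℕ) : ZMod 3)) : ℝ) : ℂ) *
        ∏ i : Fin (k + 1), qphW (ζ (g + i.val)) (η (g + i.val)) ((Fin.cons b u' : Fin (k + 1) → Bool) i)
          (memAt b₀ (Fin.cons b u' : Fin (k + 1) → Bool) i.val)) =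
        (f g s : ℂ) * qphW (ζ g) (η g) b b₀ *
          (2 ^ k * TBVW ζ η f (g + 1) k (s + 1 + ((b.toNat : ℕ) : ZMod 3)) (shiftIn b (dropOld b₀))) := by
      intro b
      rw [← ih (g + 1) (s + 1 + ((b.toNat : ℕ) : ZMod 3)) (shiftIn b (dropOld b₀)), Finset.mul_sum]
      refine Finset.sum_congr rfl fun u' _ => ?_
      rw [Finset.prod_range_succ' _ (k + 1), Fin.prod_univ_succ]
      simp only [Fin.cons_zero, Fin.cons_succ, Fin.val_zero, add_zero, Fin.val_succ, memAt_zero, memAt_cons_succ]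
      have hfac : ∀ j ∈ range (k + 1), f (g + (j + 1)) (s + (((j + 1) +
          wtPrefix (Fin.cons b u' : Fin (k + 1) → Bool) (j + 1) : ℕ) : ZMod 3)) =
          f (g + 1 + j) (s + 1 + ((b.toNat : ℕ) : ZMod 3) + ((j + wtPrefix u' j : ℕ) : ZMod 3)) := by
        intro j _
        rw [wtPrefix_cons_succ]
        congr 1
        · ring
        · push_cast; ring
      rw [Finset.prod_congr rfl hfac]
      simp only [wtPrefix_zero, Nat.cast_zero, add_zero]
      have hg : ∀ i : Fin k, g + (i.val + 1) = g + 1 + i.val := fun i => by ring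
      simp only [hg]
      push_cast
      ring
    rw [Fintype.sum_bool, hinner true, hinner false]
    simp only [Bool.toNat_true, Bool.toNat_false, Nat.cast_one, Nat.cast_zero, add_zero]
    unfold rMulW twAvgW qphW
    simp only [if_true, Bool.false_eq_true, if_false]
    rw [show s + 1 + (1 : ZMod 3) = s + 2 from by ring]
    ring

/-! ### 11c. Norm propagation along the long-memory walk -/

/-- One step. -/
theorem cnsqW_TBVW_succ_le (ζ : ℕ → (Fin (w + 1) → Bool) → ℂ) (η : ℕ → ℂ) (f : ℕ → ZMod 3 → ℝ)
    (hf : ∀ g s, f g s ^ 2 ≤ 1) (ρ : ℕ → ℝ) (hρ : ∀ g v, cnsqW (twAvgW (ζ g) (η g) v) ≤ ρ g ^ 2 * cnsqW v) (g k : ℕ) :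
    cnsqW (TBVW ζ η f g (k + 1)) ≤ ρ g ^ 2 * cnsqW (TBVW ζ η f (g + 1) k) := by
  rw [TBVW_succ]
  exact (cnsqW_rMulW_le (hf g) _).trans (hρ g _)

/-- Along the whole walk. -/
theorem cnsqW_TBVW_le (ζ : ℕ → (Fin (w + 1) → Bool) → ℂ) (η : ℕ → ℂ) (f : ℕ → ZMod 3 → ℝ)
    (hf : ∀ g s, f g s ^ 2 ≤ 1) (ρ : ℕ → ℝ) (hρ : ∀ g v, cnsqW (twAvgW (ζ g) (η g) v) ≤ ρ g ^ 2 * cnsqW v) (k : ℕ) :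
    ∀ g, cnsqW (TBVW ζ η f g k) ≤ (∏ i ∈ range k, ρ (g + i) ^ 2) * cnsqW (TBVW ζ η f (g + k) 0) := by
  induction k with
  | zero => intro g; simp
  | succ k ih =>
    intro g
    have hnonneg : 0 ≤ ρ g ^ 2 := sq_nonneg _
    calc cnsqW (TBVW ζ η f g (k + 1)) ≤ ρ g ^ 2 * cnsqW (TBVW ζ η f (g + 1) k) := cnsqW_TBVW_succ_le ζ η f hf ρ hρ g k
      _ ≤ ρ g ^ 2 * ((∏ i ∈ range k, ρ (g + 1 + i) ^ 2) * cnsqW (TBVW ζ η f (g + 1 + k) 0)) :=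
          mul_le_mul_of_nonneg_left (ih (g + 1)) hnonneg
      _ = (∏ i ∈ range (k + 1), ρ (g + i) ^ 2) * cnsqW (TBVW ζ η f (g + (k + 1)) 0) := by
          rw [Finset.prod_range_succ', add_zero, show g + 1 + k = g + (k + 1) from by ring]
          have : ∀ i ∈ range k, ρ (g + 1 + i) ^ 2 = ρ (g + (i + 1)) ^ 2 := fun i _ => by
            rw [show g + 1 + i = g + (i + 1) from by ring]
          rw [Finset.prod_congr rfl this]; ring

/-- The initial (last-cut) vector has `cnsqW ≤ 2^{w+1}` (one copy of the payoff weight per memory). -/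
theorem cnsqW_TBVW_zero_le (ζ : ℕ → (Fin (w + 1) → Bool) → ℂ) (η : ℕ → ℂ) (BN : Finset ℕ) (n : ℕ) (κ τ : ZMod 3) :
    cnsqW (TBVW ζ η (fT BN n κ τ) n 0) ≤ (2 : ℝ) ^ (w + 1) := by
  rw [TBVW_zero]
  unfold cnsqW
  have h := nsq_fT_last BN n κ τ
  have e : cnsq (fun s => ((fT BN n κ τ n s : ℝ) : ℂ)) = nsq (fT BN n κ τ n) := cnsq_ofReal _
  have hb : ∀ b : Fin (w + 1) → Bool, cnsq (fun s => ((fT BN n κ τ n s : ℝ) : ℂ)) ≤ 1 := fun _ => by rw [e]; exact h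
  calc (∑ _b : Fin (w + 1) → Bool, cnsq (fun s => ((fT BN n κ τ n s : ℝ) : ℂ)))
      ≤ ∑ _b : Fin (w + 1) → Bool, (1 : ℝ) := Finset.sum_le_sum fun b _ => hb b
    _ = (2 : ℝ) ^ (w + 1) := by simp

end TwistW

end Summit.QuantumAdvantage.QuantumAdvantage.Theorems.DigitDial
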